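import Literature.Analysis.FluidPDE.AlexakisDoeringInterpolation
import HarnessLib

/-!
# Long-time averages: monotonicity and subadditivity of `limsup` Cesàro means

Analysis/FluidPDE support file (all proved). The long-time average of the tree,
`longTimeAvgSup g = limsup_{T → ∞} T⁻¹ ∫₀ᵀ g` (`Literature/Analysis/FluidPDE/TurbWave0`,
Doering–Foias 2002, §2), is a real `limsup` of Bochner interval integrals, hence carries two
junk conventions: a non-integrable `g` has running means `0`, and unbounded running means have
`limsup = sSup ∅`-type junk. This file records the honest algebra under the hypotheses that make
both junk values disappear — pointwise nonnegative observables, integrable on every `(0, T]`,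
with eventually bounded running means:

* `timeMean_add`, `timeMean_mono_of_nonneg` — additivity / monotonicity of the running means
  (homogeneity is `timeMean_const_mul` of `AlexakisDoeringInterpolation`);
* `longTimeAvgSup_mono` — `⟨f⟩ ≤ ⟨g⟩` for `0 ≤ f ≤ g` on `(0, ∞)` when `g` is locally
  integrable with bounded running means;
* `longTimeAvgSup_add_le` — `⟨f + g⟩ ≤ ⟨f⟩ + ⟨g⟩` (Mathlib's `limsup_add_le`);
* `longTimeAvgSup_le_add_of_le_add` — the combination `⟨u⟩ ≤ ⟨f⟩ + ⟨g⟩` for `0 ≤ u ≤ f + g`;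
* `isBoundedUnder_timeMean_of_le` — bounded running means pass to smaller nonnegative
  observables.

## References

* C. Doering, C. Foias, *Energy dissipation in body-forced turbulence*, JFM 467 (2002), §2
  (long-time averages `⟨·⟩`).
-/

noncomputable section

open _root_.MeasureTheory _root_.Set _root_.Filter _root_.Topology

namespace Literature.Analysis.FluidPDE

/-! ### Running means -/

/-- **Additivity of the running means**: `T⁻¹∫₀ᵀ (f + g) = T⁻¹∫₀ᵀ f + T⁻¹∫₀ᵀ g` for `T ≥ 0`
when both observables are integrable on `(0, T]`. [folklore] -/
theorem timeMean_add {f g : ℝ → ℝ} {T : ℝ} (hT : 0 ≤ T) (hf : IntegrableOn f (Ioc 0 T))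
    (hg : IntegrableOn g (Ioc 0 T)) :
    timeMean (fun t => f t + g t) T = timeMean f T + timeMean g T := by
  unfold timeMean
  rw [intervalIntegral.integral_of_le hT, intervalIntegral.integral_of_le hT,
    intervalIntegral.integral_of_le hT, integral_add hf hg, mul_add]

/-- **Monotonicity of the running means**: if `u ≤ g` on `(0, T]` with `g` integrable on
`(0, T]` and pointwise nonnegative, then `T⁻¹∫₀ᵀ u ≤ T⁻¹∫₀ᵀ g` for `T ≥ 0` — whether or not `u` is
integrable (a non-integrable `u` has mean `0 ≤ T⁻¹∫₀ᵀ g`). [folklore] -/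
theorem timeMean_mono_of_nonneg {u g : ℝ → ℝ} {T : ℝ} (hT : 0 ≤ T) (hg0 : ∀ t, 0 ≤ g t)
    (hg : IntegrableOn g (Ioc 0 T)) (hle : ∀ t, 0 < t → t ≤ T → u t ≤ g t) :
    timeMean u T ≤ timeMean g T := by
  by_cases hu : IntegrableOn u (Ioc 0 T)
  · unfold timeMean
    rw [intervalIntegral.integral_of_le hT, intervalIntegral.integral_of_le hT]
    refine mul_le_mul_of_nonneg_left ?_ (inv_nonneg.2 hT)
    exact setIntegral_mono_on hu hg measurableSet_Ioc fun t ht => hle t ht.1 ht.2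
  · have h0 : timeMean u T = 0 := by
      unfold timeMean
      rw [intervalIntegral.integral_of_le hT, integral_undef hu, mul_zero]
    rw [h0]
    exact timeMean_nonneg hg0 hT

/-- Running means of a nonnegative observable are eventually bounded below (by `0`). [folklore] -/
theorem isBoundedUnder_ge_timeMean_of_nonneg {g : ℝ → ℝ} (hg : ∀ t, 0 ≤ g t) :
    IsBoundedUnder (· ≥ ·) atTop (timeMean g) :=
  ⟨0, (eventually_ge_atTop (0 : ℝ)).mono fun _ hT => timeMean_nonneg hg hT⟩

/-- Running means of a nonnegative observable are `limsup`-cobounded. [folklore] -/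
theorem isCoboundedUnder_le_timeMean_of_nonneg {g : ℝ → ℝ} (hg : ∀ t, 0 ≤ g t) :
    IsCoboundedUnder (· ≤ ·) atTop (timeMean g) :=
  (isBoundedUnder_ge_timeMean_of_nonneg hg).isCoboundedUnder_le

/-- **Bounded running means pass to smaller observables**: if `u ≤ g` on `(0, ∞)` with `g ≥ 0`
locally integrable and with eventually bounded running means, then the running means of `u`
are eventually bounded. [folklore] -/
theorem isBoundedUnder_timeMean_of_le {u g : ℝ → ℝ} (hg0 : ∀ t, 0 ≤ g t)
    (hgi : ∀ T, 0 < T → IntegrableOn g (Ioc 0 T)) (hle : ∀ t, 0 < t → u t ≤ g t)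
    (hb : IsBoundedUnder (· ≤ ·) atTop (timeMean g)) :
    IsBoundedUnder (· ≤ ·) atTop (timeMean u) := by
  obtain ⟨M, hM⟩ := hb
  rw [Filter.eventually_map] at hM
  refine ⟨M, ?_⟩
  rw [Filter.eventually_map]
  filter_upwards [hM, eventually_gt_atTop (0 : ℝ)] with T hT hT0
  exact (timeMean_mono_of_nonneg hT0.le hg0 (hgi T hT0) fun t ht _ => hle t ht).trans hT

/-! ### Long-time averages -/

/-- **Monotonicity of the long-time average**: `⟨u⟩ ≤ ⟨g⟩` whenever `0 ≤ u ≤ g` on `(0, ∞)`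
(`u ≥ 0` everywhere), `g ≥ 0` is integrable on every `(0, T]` and its running means are
eventually bounded (so that both `limsup`s are honest). [folklore] -/
theorem longTimeAvgSup_mono {u g : ℝ → ℝ} (hu0 : ∀ t, 0 ≤ u t) (hg0 : ∀ t, 0 ≤ g t)
    (hgi : ∀ T, 0 < T → IntegrableOn g (Ioc 0 T)) (hle : ∀ t, 0 < t → u t ≤ g t)
    (hb : IsBoundedUnder (· ≤ ·) atTop (timeMean g)) :
    longTimeAvgSup u ≤ longTimeAvgSup g := by
  unfold longTimeAvgSup
  refine limsup_le_limsup ?_ (isCoboundedUnder_le_timeMean_of_nonneg hu0) hb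
  filter_upwards [eventually_gt_atTop (0 : ℝ)] with T hT
  exact timeMean_mono_of_nonneg hT.le hg0 (hgi T hT) fun t ht _ => hle t ht

/-- **A pointwise bound gives a bound on the long-time average**: `⟨u⟩ ≤ K` if `0 ≤ u ≤ K` on
`(0, ∞)` (`u ≥ 0` everywhere). [folklore] -/
theorem longTimeAvgSup_le_const {u : ℝ → ℝ} {K : ℝ} (hu0 : ∀ t, 0 ≤ u t) (hle : ∀ t, 0 < t → u t ≤ K) :
    longTimeAvgSup u ≤ K := by
  have hK : 0 ≤ K := (hu0 1).trans (hle 1 one_pos)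
  have hmean : ∀ T, 0 < T → timeMean (fun _ => K) T = K := fun T hT => by
    unfold timeMean
    rw [intervalIntegral.integral_const, smul_eq_mul, sub_zero, ← mul_assoc, inv_mul_cancel₀ hT.ne', one_mul]
  have h1 : longTimeAvgSup u ≤ longTimeAvgSup fun _ => K :=
    longTimeAvgSup_mono hu0 (fun _ => hK) (fun T _ => integrableOn_const (hs := measure_Ioc_lt_top.ne))
      hle ⟨K, (eventually_gt_atTop (0 : ℝ)).mono fun T hT => (hmean T hT).le⟩
  have h2 : longTimeAvgSup (fun _ => K) = K := by
    unfold longTimeAvgSup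
    rw [limsup_congr ((eventually_gt_atTop (0 : ℝ)).mono fun T hT => hmean T hT)]
    exact limsup_const K
  rwa [h2] at h1

/-- **Subadditivity of the long-time average**: `⟨f + g⟩ ≤ ⟨f⟩ + ⟨g⟩` for nonnegative
observables, integrable on every `(0, T]`, with eventually bounded running means
(Mathlib's `limsup_add_le` for the running means, which add up by `timeMean_add`). [folklore] -/
theorem longTimeAvgSup_add_le {f g : ℝ → ℝ} (hf0 : ∀ t, 0 ≤ f t) (hg0 : ∀ t, 0 ≤ g t)
    (hfi : ∀ T, 0 < T → IntegrableOn f (Ioc 0 T)) (hgi : ∀ T, 0 < T → IntegrableOn g (Ioc 0 T))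
    (hfb : IsBoundedUnder (· ≤ ·) atTop (timeMean f)) (hgb : IsBoundedUnder (· ≤ ·) atTop (timeMean g)) :
    longTimeAvgSup (fun t => f t + g t) ≤ longTimeAvgSup f + longTimeAvgSup g := by
  unfold longTimeAvgSup
  have heq : timeMean (fun t => f t + g t) =ᶠ[atTop] (timeMean f + timeMean g) := by
    filter_upwards [eventually_gt_atTop (0 : ℝ)] with T hT
    rw [Pi.add_apply, timeMean_add hT.le (hfi T hT) (hgi T hT)]
  rw [limsup_congr heq]
  exact limsup_add_le (isBoundedUnder_ge_timeMean_of_nonneg hf0) hfb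
    (isCoboundedUnder_le_timeMean_of_nonneg hg0) hgb

/-- **Sub-splitting of a long-time average**: if `0 ≤ u ≤ f + g` on `(0, ∞)` with `f, g ≥ 0`
integrable on every `(0, T]` and with eventually bounded running means, then
`⟨u⟩ ≤ ⟨f⟩ + ⟨g⟩`. [folklore] -/
theorem longTimeAvgSup_le_add_of_le_add {u f g : ℝ → ℝ} (hu0 : ∀ t, 0 ≤ u t) (hf0 : ∀ t, 0 ≤ f t)
    (hg0 : ∀ t, 0 ≤ g t) (hfi : ∀ T, 0 < T → IntegrableOn f (Ioc 0 T))
    (hgi : ∀ T, 0 < T → IntegrableOn g (Ioc 0 T)) (hfb : IsBoundedUnder (· ≤ ·) atTop (timeMean f))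
    (hgb : IsBoundedUnder (· ≤ ·) atTop (timeMean g)) (hle : ∀ t, 0 < t → u t ≤ f t + g t) :
    longTimeAvgSup u ≤ longTimeAvgSup f + longTimeAvgSup g := by
  have hsum_b : IsBoundedUnder (· ≤ ·) atTop (timeMean fun t => f t + g t) := by
    obtain ⟨A, hA⟩ := hfb
    obtain ⟨B, hB⟩ := hgb
    rw [Filter.eventually_map] at hA hB
    refine ⟨A + B, ?_⟩
    rw [Filter.eventually_map]
    filter_upwards [hA, hB, eventually_gt_atTop (0 : ℝ)] with T hA' hB' hT
    rw [timeMean_add hT.le (hfi T hT) (hgi T hT)]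
    exact add_le_add hA' hB'
  refine (longTimeAvgSup_mono hu0 (fun t => add_nonneg (hf0 t) (hg0 t))
    (fun T hT => (hfi T hT).add (hgi T hT)) hle hsum_b).trans ?_
  exact longTimeAvgSup_add_le hf0 hg0 hfi hgi hfb hgb

/-- Bounded running means are preserved by nonnegative scaling. [folklore] -/
theorem isBoundedUnder_timeMean_const_mul {g : ℝ → ℝ} {c : ℝ} (hc : 0 ≤ c)
    (hb : IsBoundedUnder (· ≤ ·) atTop (timeMean g)) :
    IsBoundedUnder (· ≤ ·) atTop (timeMean fun t => c * g t) := by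
  obtain ⟨M, hM⟩ := hb
  rw [Filter.eventually_map] at hM
  refine ⟨c * M, ?_⟩
  rw [Filter.eventually_map]
  filter_upwards [hM] with T hT
  rw [timeMean_const_mul]
  exact mul_le_mul_of_nonneg_left hT hc

/-- **Bounded running means from a linear integrated bound**: if `g ≥ 0` and
`∫_{(0,T]} g ≤ A + B T` for all `T > 0`, then the running means of `g` are eventually bounded
(by `|A| + |B|` for `T ≥ 1`). [folklore] -/
theorem isBoundedUnder_timeMean_of_setIntegral_le_linear {g : ℝ → ℝ} {A B : ℝ}
    (h : ∀ T, 0 < T → ∫ t in Ioc 0 T, g t ≤ A + B * T) :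
    IsBoundedUnder (· ≤ ·) atTop (timeMean g) := by
  refine ⟨|A| + |B|, ?_⟩
  rw [Filter.eventually_map]
  filter_upwards [eventually_ge_atTop (1 : ℝ)] with T hT1
  have hT : 0 < T := by linarith
  unfold timeMean
  rw [intervalIntegral.integral_of_le hT.le]
  have hTinv : 0 ≤ T⁻¹ := inv_nonneg.2 hT.le
  calc T⁻¹ * ∫ t in Ioc 0 T, g t ≤ T⁻¹ * (A + B * T) := mul_le_mul_of_nonneg_left (h T hT) hTinv
    _ = T⁻¹ * A + B := by field_simp
    _ ≤ |A| + |B| := by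
        have h1 : T⁻¹ * A ≤ |A| := by
          calc T⁻¹ * A ≤ T⁻¹ * |A| := mul_le_mul_of_nonneg_left (le_abs_self A) hTinv
            _ ≤ 1 * |A| := mul_le_mul_of_nonneg_right (inv_le_one_of_one_le₀ hT1) (abs_nonneg A)
            _ = |A| := one_mul _
        linarith [le_abs_self B]

end Literature.Analysis.FluidPDE

end
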